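import Summits.BirchSwinnertonDyer.BirchSwinnertonDyer.Theorems.ByReductionTypeAtTwoSupersingularHondaSystemAtTwoDual
import Summits.BirchSwinnertonDyer.BirchSwinnertonDyer.Theorems.ByReductionTypeAtTwoSupersingularHondaSystemAtTwoSprungPrimal
import HarnessLib

/-!
# Sprung's Honda system AT `p = 2`, VIII: **(C1) `F1Sign2.HondaSystemAtTwoExists` — the `2`-adic Honda system on the
# cyclotomic `ℤ₂`-line EXISTS for every globally minimal `W/ℚ` with good supersingular reduction at `2` (`a₂ ∈ {0, ±2}`)**

Seat `bsd-2adic-tower-1` GEN 66, hand H2-C1 (pen GEN 40 SUMMON 20260831T155847Z); crux `SupersingularRankZeroAtTwo`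
(item stmt-BirchSwinnertonDyer-19097), line `odd_blind_package` v2.14: stub 2's conjuncts (1)–(6) follow from (C1) BY NAME
(`SSFlatLocalData.flatLocalData_of_hondaSystemAtTwoExists`, p827135). Sequel of I (`…Dual`) and VII (`…SprungPrimal`: the primal data
`(cneg, c)` over `ℚ_[2]` for every embedding `ι` and every even `a₂`).

WHAT (THEOREMS ONLY; no definition, no named fact, no instance, no `sorry`; route-independent — no `Theses` import):
* §1 `sprungPrimal_modelTransport`, `sprungPrimal_adicCompletion_of_padic` — the primal package (levels, the three relations of
  `IsHondaSystemAtTwo` with constant `a`, (GEN) with multiplier `q`, (NONDIV)) moves along an isomorphism of models, in particular from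
  (`ℚ_[2]`, every `ι`) to (`ℚ_v`, `closureEmb`) (w3's transport engine `SignedEC.modelMap_*`, `exists_model_padic_adicCompletion`);
* §2 ★ **`hondaSystemAtTwoExists : F1Sign2.HondaSystemAtTwoExists`** — VII transported, (GEN₀) `E(ℚ_v) ⊆ ℤ·cneg + 2E(ℚ_v)` from
  (NONDIV) by Milne I 3.3 (`SignedEC.plusGenZero_two_of_ne_two_nsmul`), and the four dual clauses by `isHondaSystemAtTwo_of_primal` (I)
  with `N = 1`; §3 the alias `F1Sign2.hondaSystemAtTwoExists_holds` in the cell's namespace.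
HONEST FRAMING: (C1) is a LOCAL existence statement (Sprung 2012 Thm. 2.2 read at `2` with the computed bottom constants); it is a
binder of stub 2 of line `odd_blind_package` and closes no stub and no item by itself; nothing booked; BSD is proved for no curve by
any of this.

References: [Sprung2012] F. Sprung, J. Number Theory 132 (2012), Thm. 2.2 (pp. 1486–1487), Cor. 2.10, Lemma 2.3; [Kobayashi2003]
S. Kobayashi, Invent. Math. 152 (2003), §8 (Lemma 8.9, Props. 8.7, 8.11, 8.12); [Honda1970] Thm. 2, Thm. 9; [KuriharaOtsuki2006]
p. 557; [MilneADT2006] I Lemma 3.3; [SerreGaloisCohomology1997] II.§1.1; cell memo MEMO-imc §10.90 / REF1 §139 (B0), R1–R3.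
-/

set_option autoImplicit false
-- the Theorems namespace of this sub repeats the summit name by design (D-0017 nested layout)
set_option linter.dupNamespace false

noncomputable section

open scoped Classical NumberField

namespace Summit.BirchSwinnertonDyer.BirchSwinnertonDyer.Theorems.SSHondaTwo

open Field WeierstrassCurve NumberField IsDedekindDomain Literature.NumberTheory.EllipticCurves
  Literature.NumberTheory.GaloisRepresentations
  Literature.NumberTheory.EllipticCurves.ZpExtension Literature.NumberTheory.EllipticCurves.Kobayashi2003
  Literature.NumberTheory.EllipticCurves.Rank1Residual
  Summit.BirchSwinnertonDyer.Rank1Residual.Additive.LocalTransport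
  Summit.BirchSwinnertonDyer.BirchSwinnertonDyer.Theorems.SignedEC
  Summit.BirchSwinnertonDyer.Rank1Residual.F1Sign2

/-! ## §1 Transport `ℚ_[2] → ℚ_v` of the primal package -/

section Generic

variable {K : Type} [Field K] {E : Type} [Field E] [Algebra K E] {E' : Type} [Field E'] [Algebra K E']
  (Φ : AlgebraicClosure E ≃ₐ[K] AlgebraicClosure E') (φ : E ≃+* E')
  (hf : ∀ y : E, Φ (algebraMap E (AlgebraicClosure E) y) = algebraMap E' (AlgebraicClosure E') (φ y))
  (ι : AlgebraicClosure K →ₐ[K] AlgebraicClosure E) (ι' : AlgebraicClosure K →ₐ[K] AlgebraicClosure E')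
  (hcompat : ∀ z : AlgebraicClosure K, ι' z = Φ (ι z))
  (W : WeierstrassCurve K) (T : localPoints W E →+ localPoints W E')
  (hT : ∀ P : localPoints W E, T P =
    WeierstrassCurve.Affine.Point.map (W' := W) (Φ : AlgebraicClosure E →ₐ[K] AlgebraicClosure E')
      (show (W.baseChange (AlgebraicClosure E)).toAffine.Point from P))
  {p : ℕ} [Fact p.Prime] (κ : ZpExtension K p)

include hf hcompat hT in
/-- **The primal package (levels, the three `IsHondaSystemAtTwo` relations with constant `a`, (GEN), (NONDIV)) moves along an
isomorphism of models** `(cneg, d) ↦ (T cneg, T ∘ d)`. [cite: SerreGaloisCohomology1997, II.§1.1] [cite: Kobayashi2003, Def. 1.1] -/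
theorem sprungPrimal_modelTransport (a : ℤ) (q : ℕ)
    (h : ∃ (cneg : localPoints W E) (d : ℕ → localPoints W E),
      cneg ∈ localLayerPointsOfEmb κ ι W 0 ∧ (∀ m, d m ∈ localLayerPointsOfEmb κ ι W m) ∧
      d 0 = (a ^ 2 - 2 * a - 1) • cneg ∧
      localTraceOfEmb κ ι W 0 1 (d 1) = a • d 0 + (4 - 2 * a) • cneg ∧
      (∀ n : ℕ, 1 ≤ n → localTraceOfEmb κ ι W n (n + 1) (d (n + 1)) = a • d n - d (n - 1)) ∧
      (∀ m : ℕ, 1 ≤ m → ∀ P ∈ localLayerPointsOfEmb κ ι W m,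
        ∃ B ∈ AddSubgroup.closure (Set.range fun σ : Field.absoluteGaloisGroup E ↦ σ • d m),
          ∃ P' ∈ localLayerPointsOfEmb κ ι W (m - 1), ∃ R ∈ localLayerPointsOfEmb κ ι W m, P = B + P' + q • R) ∧
      (∀ b ∈ localLayerPointsOfEmb κ ι W 0, cneg ≠ q • b)) :
    ∃ (cneg : localPoints W E') (d : ℕ → localPoints W E'),
      cneg ∈ localLayerPointsOfEmb κ ι' W 0 ∧ (∀ m, d m ∈ localLayerPointsOfEmb κ ι' W m) ∧
      d 0 = (a ^ 2 - 2 * a - 1) • cneg ∧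
      localTraceOfEmb κ ι' W 0 1 (d 1) = a • d 0 + (4 - 2 * a) • cneg ∧
      (∀ n : ℕ, 1 ≤ n → localTraceOfEmb κ ι' W n (n + 1) (d (n + 1)) = a • d n - d (n - 1)) ∧
      (∀ m : ℕ, 1 ≤ m → ∀ P ∈ localLayerPointsOfEmb κ ι' W m,
        ∃ B ∈ AddSubgroup.closure (Set.range fun σ : Field.absoluteGaloisGroup E' ↦ σ • d m),
          ∃ P' ∈ localLayerPointsOfEmb κ ι' W (m - 1), ∃ R ∈ localLayerPointsOfEmb κ ι' W m, P = B + P' + q • R) ∧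
      (∀ b ∈ localLayerPointsOfEmb κ ι' W 0, cneg ≠ q • b) := by
  have hmem := modelMap_mem_localLayerPointsOfEmb_iff Φ φ hf ι ι' hcompat W T hT κ
  obtain ⟨cneg, d, hcneg, hd, hR0, hR1, hRn, hgen, hnd⟩ := h
  refine ⟨T cneg, fun m ↦ T (d m), (hmem 0 _).mpr hcneg, fun m ↦ (hmem m _).mpr (hd m), ?_, ?_, ?_,
    fun m hm P' hP' ↦ ?_, nonDiv_modelTransport Φ φ hf ι ι' hcompat W T hT κ q hnd⟩
  · dsimp only
    rw [hR0, map_zsmul]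
  · dsimp only
    rw [← modelMap_localTraceOfEmb Φ φ hf ι ι' hcompat W T hT κ 0 1 (hd 1), hR1, map_add, map_zsmul, map_zsmul]
  · intro n hn
    dsimp only
    rw [← modelMap_localTraceOfEmb Φ φ hf ι ι' hcompat W T hT κ n (n + 1) (hd (n + 1)), hRn n hn, map_sub, map_zsmul]
  · obtain ⟨P, rfl⟩ := modelMap_surjective Φ W T hT P'
    obtain ⟨B, hB, P₁, hP₁, R, hR, hPe⟩ := hgen m hm P ((hmem m P).mp hP')
    refine ⟨T B, ?_, T P₁, (hmem _ _).mpr hP₁, T R, (hmem _ _).mpr hR, by rw [hPe, map_add, map_add, map_nsmul]⟩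
    rw [← map_modelMap_closure_orbit Φ φ hf W T hT]
    exact AddSubgroup.mem_map_of_mem T hB

end Generic

/-- **The primal package: (`ℚ_[p]`, every `ι`) ⟹ (`ℚ_v`, `closureEmb`)** at the place `v ∋ p`.
[cite: SerreGaloisCohomology1997, II.§1.1] [cite: MilneFT2022, Ch. 6] -/
theorem sprungPrimal_adicCompletion_of_padic {p : ℕ} [Fact p.Prime] (W : WeierstrassCurve ℚ) (κ : ZpExtension ℚ p)
    (a : ℤ) (q : ℕ) (v : HeightOneSpectrum (𝓞 ℚ)) (hv : (p : 𝓞 ℚ) ∈ v.asIdeal)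
    (h : ∀ ι : AlgebraicClosure ℚ →ₐ[ℚ] AlgebraicClosure ℚ_[p], ∃ (cneg : localPoints W ℚ_[p]) (d : ℕ → localPoints W ℚ_[p]),
      cneg ∈ localLayerPointsOfEmb κ ι W 0 ∧ (∀ m, d m ∈ localLayerPointsOfEmb κ ι W m) ∧
      d 0 = (a ^ 2 - 2 * a - 1) • cneg ∧
      localTraceOfEmb κ ι W 0 1 (d 1) = a • d 0 + (4 - 2 * a) • cneg ∧
      (∀ n : ℕ, 1 ≤ n → localTraceOfEmb κ ι W n (n + 1) (d (n + 1)) = a • d n - d (n - 1)) ∧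
      (∀ m : ℕ, 1 ≤ m → ∀ P ∈ localLayerPointsOfEmb κ ι W m,
        ∃ B ∈ AddSubgroup.closure (Set.range fun σ : Field.absoluteGaloisGroup ℚ_[p] ↦ σ • d m),
          ∃ P' ∈ localLayerPointsOfEmb κ ι W (m - 1), ∃ R ∈ localLayerPointsOfEmb κ ι W m, P = B + P' + q • R) ∧
      (∀ b ∈ localLayerPointsOfEmb κ ι W 0, cneg ≠ q • b)) :
    ∃ (cneg : localPoints W (v.adicCompletion ℚ)) (d : ℕ → localPoints W (v.adicCompletion ℚ)),
      cneg ∈ localLayerPointsOfEmb κ (closureEmb (K := ℚ) (v.adicCompletion ℚ)) W 0 ∧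
      (∀ m, d m ∈ localLayerPointsOfEmb κ (closureEmb (K := ℚ) (v.adicCompletion ℚ)) W m) ∧
      d 0 = (a ^ 2 - 2 * a - 1) • cneg ∧
      localTraceOfEmb κ (closureEmb (K := ℚ) (v.adicCompletion ℚ)) W 0 1 (d 1) = a • d 0 + (4 - 2 * a) • cneg ∧
      (∀ n : ℕ, 1 ≤ n → localTraceOfEmb κ (closureEmb (K := ℚ) (v.adicCompletion ℚ)) W n (n + 1) (d (n + 1)) =
        a • d n - d (n - 1)) ∧
      (∀ m : ℕ, 1 ≤ m → ∀ P ∈ localLayerPointsOfEmb κ (closureEmb (K := ℚ) (v.adicCompletion ℚ)) W m,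
        ∃ B ∈ AddSubgroup.closure (Set.range fun σ : Field.absoluteGaloisGroup (v.adicCompletion ℚ) ↦ σ • d m),
          ∃ P' ∈ localLayerPointsOfEmb κ (closureEmb (K := ℚ) (v.adicCompletion ℚ)) W (m - 1),
          ∃ R ∈ localLayerPointsOfEmb κ (closureEmb (K := ℚ) (v.adicCompletion ℚ)) W m, P = B + P' + q • R) ∧
      (∀ b ∈ localLayerPointsOfEmb κ (closureEmb (K := ℚ) (v.adicCompletion ℚ)) W 0, cneg ≠ q • b) := by
  obtain ⟨Φ, φ, hf, ι, hcompat⟩ := exists_model_padic_adicCompletion (p := p) hv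
  exact sprungPrimal_modelTransport Φ φ hf ι (closureEmb (K := ℚ) (v.adicCompletion ℚ)) hcompat W
    (show localPoints W ℚ_[p] →+ localPoints W (v.adicCompletion ℚ) from
      WeierstrassCurve.Affine.Point.map (W' := W) (Φ : AlgebraicClosure ℚ_[p] →ₐ[ℚ] AlgebraicClosure (v.adicCompletion ℚ)))
    (fun _ ↦ rfl) κ a q (h ι)

/-! ## §2 (C1): the `2`-adic Honda system on the `ℤ₂`-line exists -/

/-- **(C1) `F1Sign2.HondaSystemAtTwoExists` — Sprung 2012 Thm. 2.2 in `ℤ₂`-tower form AT `p = 2`, PROVED**: for every `W/ℚ`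
elliptic and globally minimal with good supersingular reduction at `2` (`2 ∣ a₂`, i.e. `a₂ ∈ {0, ±2}`), the cyclotomic `ℤ₂`-extension
`(κ, γ)` and a local lift `g` of `γ` at `v ∣ 2`, there are `cneg ∈ E(ℚ_v)` and `c : ℕ → E(ℚ̄_v)` with
`IsHondaSystemAtTwo κ (closureEmb ℚ_v) W (W.frobeniusTrace 2) g cneg c` — levels, the COMPUTED bottom relations
`c_0 = (a² − 2a − 1)•cneg`, `Tr_{1/0} c_1 = a•c_0 + (4 − 2a)•cneg`, the generic relation, and the four dual generation clauses.
The Sprung plus points (file VII) transported to `ℚ_v` (§1), (GEN₀) by Milne I 3.3 (`SignedEC.plusGenZero_two_of_ne_two_nsmul`), the dual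
clauses by `isHondaSystemAtTwo_of_primal` (file I). The binders `γ`, `IsCyclotomicVariable` are carried, not used.
[cite: Sprung2012, Thm. 2.2 (pp. 1486–1487), Cor. 2.10 (p. 1489), Lemma 2.3] [cite: Kobayashi2003, Lemma 8.9, Prop. 8.11, Prop. 8.12]
[cite: Honda1970, Thm. 2, Thm. 9] [cite: MilneADT2006, I Lemma 3.3] -/
theorem hondaSystemAtTwoExists : HondaSystemAtTwoExists := by
  intro W _ _ hgood hap κ γ hκ _ _ v hv g hg
  have hss : GoodSS W 2 := ⟨hgood, hap⟩
  set ι := closureEmb (K := ℚ) (v.adicCompletion ℚ) with hι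
  obtain ⟨cneg, d, hcneg, hL, hR0, hR1, hRn, hGEN, hND⟩ :=
    sprungPrimal_adicCompletion_of_padic W κ (W.frobeniusTrace 2) 2 v (by exact_mod_cast hv)
      fun ι₂ ↦ sprungPrimal_padic W hss κ hκ ι₂
  have hGEN0 := plusGenZero_two_of_ne_two_nsmul W hss κ v hv ι hcneg hND
  refine ⟨cneg, d, isHondaSystemAtTwo_of_primal ι W κ (isUnit_sq_sub_two_mul_sub_one_of_even hap) hg
    (N := 1) (Nat.coprime_one_left 2) hcneg hL hR0 hR1 hRn ?_ ?_⟩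
  · intro m hm P hP
    obtain ⟨B, hB, P', hP', R, hR, h⟩ := hGEN m hm P hP
    exact ⟨B, hB, P', hP', R, hR, by rw [one_nsmul]; exact h⟩
  · intro P hP
    obtain ⟨u, R, hR, h⟩ := hGEN0 P hP
    exact ⟨u, R, hR, by rw [one_nsmul]; exact h⟩

end Summit.BirchSwinnertonDyer.BirchSwinnertonDyer.Theorems.SSHondaTwo

/-! ## §3 The conclusion BY NAME in the cell's namespace (`F1Sign2.hondaSystemAtTwoExists_holds`) -/

namespace Summit.BirchSwinnertonDyer.Rank1Residual.F1Sign2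

/-- **`HondaSystemAtTwoExists` HOLDS** (alias of `SSHondaTwo.hondaSystemAtTwoExists` under the cell's naming convention
`F1Sign2.hondaSystemAtTwoExists_holds`). [cite: Sprung2012, Thm. 2.2 (p. 1487)] [cite: Kobayashi2003, Prop. 8.12] -/
theorem hondaSystemAtTwoExists_holds : HondaSystemAtTwoExists :=
  Summit.BirchSwinnertonDyer.BirchSwinnertonDyer.Theorems.SSHondaTwo.hondaSystemAtTwoExists

end Summit.BirchSwinnertonDyer.Rank1Residual.F1Sign2

end
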